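import Mathlib
import HarnessLib
import Literature.MathematicalPhysics.QuantumFieldTheory.OSReconstructionNoE1Proofs

/-!
# `CurvatureKernelBound` — stub A1 support: the Osterwalder–Schrader semigroup derivative bound

Support file for crux `stmt-QuantumFields-11687` (`PencilRigidity.CurvatureKernelBound`), line
`sixteen-charts-analytic-kernel`, stub `ChartDerivativeBounds` (A1).  The spectral half of
Osterwalder–Schrader's estimate `‖Hᴺ e^{-tH}‖ ≤ (N/(e t))ᴺ` [OS 1973 §4.1; Glimm–Jaffe Thm 6.1.3],
phrased WITHOUT the unbounded generator `H`: for `h : OSReconstructionNoE1 S` and vectors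
`ψ₁, ψ₂` of the OS Hilbert space,

* `pow_mul_exp_neg_mul_le`: `λᴺ e^{-aλ} ≤ (N/(e a))ᴺ` for `λ ≥ 0`, `a > 0`;
* Laplace transforms `Lⱼ(t) = ∫ (−p₀)ʲ e^{−t p₀} dμ` of a finite measure carried by `{p₀ ≥ 0}`:
  `hasDerivAt_laplace_moment` (`Lⱼ' = Lⱼ₊₁` on `t > 0`), `norm_laplace_moment_le`
  (`|Lⱼ(t)| ≤ (j/(e t))ʲ μ(univ)`);
* `inner_transfer_eq_laplace`: `⟪u, e^{-tH} u⟫ = L₀[μ_u](t)` for the joint spectral measure `μ_u`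
  (`exists_isJointSpectralMeasure_holds`), and the polarised form `inner_transfer_polarization`;
* **`SemigroupDerivativeBound`** (registered sub-goal): if `G : ℕ → ℝ → ℂ` satisfies
  `G 0 t = ⟪ψ₁, e^{-tH} ψ₂⟫` and `Gⱼ' = Gⱼ₊₁` on `t > 0`, then
  `‖G N t‖ ≤ (N/(e t))ᴺ (‖ψ₁‖² + ‖ψ₂‖²)` — the `N`-th derivative of `t ↦ ⟪ψ₁, e^{-tH}ψ₂⟫` identified
  with `∑ₖ cₖ ∫ (−p₀)ᴺ e^{−tp₀} dμₖ` by uniqueness of derivatives along the induction.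
[folklore]
-/

noncomputable section

open scoped InnerProductSpace ComplexConjugate
open MeasureTheory Filter Set
open _root_.Topology
open Literature.MathematicalPhysics.AQFT Literature.MathematicalPhysics.QuantumLattice
open Literature.MathematicalPhysics.QuantumFieldTheory

namespace Summit.QuantumFields.YangMills.Theorems.CurvatureKernel

/-! ## The elementary bound `λᴺ e^{-aλ} ≤ (N/(ea))ᴺ` -/

/-- `x e^{-a x / N} ≤ N/(e a)` for `x ≥ 0`, `a > 0`, `N ≥ 1` (from `y ≤ e^{y-1}`). [folklore] -/
theorem mul_exp_neg_div_le (x : ℝ) {a : ℝ} (ha : 0 < a) {N : ℕ} (hN : 0 < N) :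
    x * Real.exp (-(a * x) / N) ≤ N / (Real.exp 1 * a) := by
  have hNr : (0 : ℝ) < N := by exact_mod_cast hN
  set y : ℝ := a * x / N with hy
  have h1 : y ≤ Real.exp y / Real.exp 1 := by
    have h := Real.add_one_le_exp (y - 1)
    rw [Real.exp_sub] at h
    linarith
  have hx' : x = N / a * y := by rw [hy]; field_simp
  have hexp : Real.exp (-(a * x) / N) = (Real.exp y)⁻¹ := by
    rw [← Real.exp_neg, hy, neg_div]
  rw [hexp, hx']
  calc N / a * y * (Real.exp y)⁻¹ = N / a * (y * (Real.exp y)⁻¹) := by ring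
    _ ≤ N / a * (Real.exp y / Real.exp 1 * (Real.exp y)⁻¹) := by gcongr
    _ = N / (Real.exp 1 * a) := by field_simp

/-- **`λᴺ e^{-aλ} ≤ (N/(e a))ᴺ`** for `λ ≥ 0`, `a > 0` (`sup_λ λᴺe^{-aλ}` is attained at `λ = N/a`).
[folklore] -/
theorem pow_mul_exp_neg_mul_le {x a : ℝ} (hx : 0 ≤ x) (ha : 0 < a) (N : ℕ) :
    x ^ N * Real.exp (-(a * x)) ≤ (N / (Real.exp 1 * a)) ^ N := by
  rcases Nat.eq_zero_or_pos N with rfl | hN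
  · have : Real.exp (-(a * x)) ≤ 1 := Real.exp_le_one_iff.2 (by nlinarith)
    simpa using this
  · have hNr : (0 : ℝ) < N := by exact_mod_cast hN
    have hpow : x ^ N * Real.exp (-(a * x)) = (x * Real.exp (-(a * x) / N)) ^ N := by
      rw [mul_pow, ← Real.exp_nat_mul]
      congr 2
      field_simp
    rw [hpow]
    exact pow_le_pow_left₀ (by positivity) (mul_exp_neg_div_le x ha hN) N

/-! ## Laplace transforms of finite measures on `{p₀ ≥ 0}` -/

section Laplace

variable {d : ℕ} [NeZero d] {μ : Measure (EuclideanSpace ℝ (Fin d))}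

/-- A measure carried by `{p₀ ≥ 0}` has `p₀ ≥ 0` almost everywhere. [folklore] -/
theorem ae_energy_nonneg (hμ : μ {p | p 0 < 0} = 0) : ∀ᵐ p ∂μ, 0 ≤ p 0 := by
  rw [measure_eq_zero_iff_ae_notMem] at hμ
  filter_upwards [hμ] with p hp
  simpa using hp

/-- The integrand `(−p₀)ʲ e^{−t p₀}` is continuous in `p`. [folklore] -/
theorem continuous_laplace_integrand (j : ℕ) (t : ℝ) :
    Continuous fun p : EuclideanSpace ℝ (Fin d) => (-(p 0)) ^ j * Real.exp (-(t * p 0)) := by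
  have hc : Continuous fun p : EuclideanSpace ℝ (Fin d) => p 0 := PiLp.continuous_apply 2 _ 0
  fun_prop

/-- Pointwise bound `|(−p₀)ʲ e^{−τ p₀}| ≤ (j/(e a))ʲ` for `p₀ ≥ 0` and `τ ≥ a > 0`. [folklore] -/
theorem norm_laplace_integrand_le {p : EuclideanSpace ℝ (Fin d)} (hp : 0 ≤ p 0) (j : ℕ) {a τ : ℝ}
    (ha : 0 < a) (hτ : a ≤ τ) :
    ‖(-(p 0)) ^ j * Real.exp (-(τ * p 0))‖ ≤ (j / (Real.exp 1 * a)) ^ j := by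
  rw [norm_mul, norm_pow, Real.norm_eq_abs, abs_neg, abs_of_nonneg hp, Real.norm_eq_abs,
    Real.abs_exp]
  calc p 0 ^ j * Real.exp (-(τ * p 0)) ≤ p 0 ^ j * Real.exp (-(a * p 0)) := by
        gcongr
    _ ≤ (j / (Real.exp 1 * a)) ^ j := pow_mul_exp_neg_mul_le hp ha j

/-- The Laplace moments are integrable for `t > 0`. [folklore] -/
theorem integrable_laplace_integrand [IsFiniteMeasure μ] (hμ : μ {p | p 0 < 0} = 0) (j : ℕ) {t : ℝ}
    (ht : 0 < t) :
    Integrable (fun p : EuclideanSpace ℝ (Fin d) => (-(p 0)) ^ j * Real.exp (-(t * p 0))) μ := by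
  refine Integrable.of_bound (continuous_laplace_integrand j t).aestronglyMeasurable
    ((j / (Real.exp 1 * t)) ^ j) ?_
  filter_upwards [ae_energy_nonneg hμ] with p hp
  exact norm_laplace_integrand_le hp j ht le_rfl

/-- **`|Lⱼ(t)| ≤ (j/(e t))ʲ μ(univ)`** for the Laplace moment `Lⱼ(t) = ∫ (−p₀)ʲ e^{−tp₀} dμ`, `t > 0`. [folklore] -/
theorem norm_laplace_moment_le [IsFiniteMeasure μ] (hμ : μ {p | p 0 < 0} = 0) (j : ℕ) {t : ℝ}
    (ht : 0 < t) :
    ‖∫ p, (-(p 0)) ^ j * Real.exp (-(t * p 0)) ∂μ‖ ≤ (j / (Real.exp 1 * t)) ^ j * μ.real univ := by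
  refine norm_integral_le_of_norm_le_const ?_
  filter_upwards [ae_energy_nonneg hμ] with p hp
  exact norm_laplace_integrand_le hp j ht le_rfl

/-- **Differentiation under the integral**: `d/dt ∫ (−p₀)ʲ e^{−tp₀} dμ = ∫ (−p₀)ʲ⁺¹ e^{−tp₀} dμ` for
`t > 0` (dominated by the constant `((j+1)/(e t/2))ʲ⁺¹` on `τ > t/2`). [folklore] -/
theorem hasDerivAt_laplace_moment [IsFiniteMeasure μ] (hμ : μ {p | p 0 < 0} = 0) (j : ℕ) {t : ℝ}
    (ht : 0 < t) :
    HasDerivAt (fun τ : ℝ => ∫ p, (-(p 0)) ^ j * Real.exp (-(τ * p 0)) ∂μ)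
      (∫ p, (-(p 0)) ^ (j + 1) * Real.exp (-(t * p 0)) ∂μ) t := by
  have ht2 : 0 < t / 2 := by positivity
  have hs : Ioi (t / 2) ∈ 𝓝 t := Ioi_mem_nhds (by linarith)
  have h := hasDerivAt_integral_of_dominated_loc_of_deriv_le (μ := μ) (x₀ := t)
    (F := fun τ p => (-(p 0)) ^ j * Real.exp (-(τ * p 0)))
    (F' := fun τ p => (-(p 0)) ^ (j + 1) * Real.exp (-(τ * p 0)))
    (bound := fun _ => ((j + 1 : ℕ) / (Real.exp 1 * (t / 2))) ^ (j + 1)) hs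
    (Eventually.of_forall fun τ => (continuous_laplace_integrand j τ).aestronglyMeasurable)
    (integrable_laplace_integrand hμ j ht)
    (continuous_laplace_integrand (j + 1) t).aestronglyMeasurable ?_ (integrable_const _) ?_
  · exact h.2
  · filter_upwards [ae_energy_nonneg hμ] with p hp τ hτ
    exact norm_laplace_integrand_le hp (j + 1) ht2 (le_of_lt hτ)
  · refine Eventually.of_forall fun p τ _ => ?_
    have h1 : HasDerivAt (fun σ : ℝ => -(σ * p 0)) (-(p 0)) τ := by
      simpa using ((hasDerivAt_id τ).mul_const (p 0)).fun_neg
    have h2 := (h1.exp).const_mul ((-(p 0)) ^ j)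
    have heq : (-(p 0)) ^ j * (Real.exp (-(τ * p 0)) * -(p 0)) =
        (-(p 0)) ^ (j + 1) * Real.exp (-(τ * p 0)) := by rw [pow_succ]; ring
    rw [heq] at h2
    exact h2

end Laplace

/-! ## The OS Hilbert space: spectral representation and polarisation -/

section Hilbert

universe u

variable {ι : Type u} {d : ℕ} [NeZero d] {S : LabelledSchwingerFamily ι (EuclideanSpace ℝ (Fin d))}
  (h : OSReconstructionNoE1 S)

/-- **Spectral representation of the diagonal**: `⟪u, e^{-tH} u⟫ = ∫ e^{−tp₀} dμ_u(p)` for the joint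
spectral measure `μ_u = h.jointSpectralMeasure u` (which exists by
`exists_isJointSpectralMeasure_holds`), written as the zeroth Laplace moment. [folklore] -/
theorem inner_transfer_eq_laplace (u : h.Hilbert) {t : ℝ} (ht : 0 ≤ t) :
    ⟪u, h.transfer t u⟫_ℂ =
      ((∫ p, (-(p 0)) ^ 0 * Real.exp (-(t * p 0)) ∂(h.jointSpectralMeasure u) : ℝ) : ℂ) := by
  have hμ := h.isJointSpectralMeasure_of_exists
    OSReconstructionNoE1.exists_isJointSpectralMeasure_holds u
  rw [hμ.inner_transfer h ht, ← integral_complex_ofReal]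
  refine integral_congr_ae (Eventually.of_forall fun p => ?_)
  simp only [pow_zero, one_mul, Complex.ofReal_exp]

/-- **Polarisation** of `⟪ψ₁, e^{-tH} ψ₂⟫` into four diagonal terms (`e^{-tH}` is self-adjoint). [folklore] -/
theorem inner_transfer_polarization (ψ₁ ψ₂ : h.Hilbert) (t : ℝ) :
    ⟪ψ₁, h.transfer t ψ₂⟫_ℂ =
      (⟪ψ₁ + ψ₂, h.transfer t (ψ₁ + ψ₂)⟫_ℂ - ⟪ψ₁ - ψ₂, h.transfer t (ψ₁ - ψ₂)⟫_ℂ -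
          Complex.I * ⟪ψ₁ + Complex.I • ψ₂, h.transfer t (ψ₁ + Complex.I • ψ₂)⟫_ℂ +
        Complex.I * ⟪ψ₁ - Complex.I • ψ₂, h.transfer t (ψ₁ - Complex.I • ψ₂)⟫_ℂ) / 4 := by
  rw [← h.inner_transfer_left]
  have hp := inner_map_polarization' ((h.transfer t : h.Hilbert →L[ℂ] h.Hilbert) : h.Hilbert →ₗ[ℂ] h.Hilbert)
    ψ₁ ψ₂
  simp only [ContinuousLinearMap.coe_coe] at hp
  rw [hp, h.inner_transfer_left, h.inner_transfer_left, h.inner_transfer_left, h.inner_transfer_left]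

/-- **The Osterwalder–Schrader semigroup derivative bound** (OS 1973 §4.1 (4.6)–(4.10); Glimm–Jaffe
Thm. 6.1.3, `‖Hᴺ e^{-tH}‖ ≤ (N/(et))ᴺ`), generator-free form: if `G : ℕ → ℝ → ℂ` starts at
`G 0 t = ⟪ψ₁, e^{-tH} ψ₂⟫` and each `Gⱼ` has derivative `Gⱼ₊₁` on `t > 0`, then
`‖G N t‖ ≤ (N/(e t))ᴺ (‖ψ₁‖² + ‖ψ₂‖²)`.  Proof: polarisation, the joint spectral measures of the four
vectors `ψ₁ ± ψ₂`, `ψ₁ ± iψ₂`, differentiation of the Laplace transforms under the integral, uniqueness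
of derivatives along the induction, `λᴺe^{-tλ} ≤ (N/(et))ᴺ` and the parallelogram law. [folklore] -/
theorem norm_iterDeriv_inner_transfer_le (ψ₁ ψ₂ : h.Hilbert) (G : ℕ → ℝ → ℂ)
    (h0 : ∀ t : ℝ, 0 < t → G 0 t = ⟪ψ₁, h.transfer t ψ₂⟫_ℂ)
    (hd : ∀ (j : ℕ) (t : ℝ), 0 < t → HasDerivAt (G j) (G (j + 1) t) t) (N : ℕ) {t : ℝ} (ht : 0 < t) :
    ‖G N t‖ ≤ (N / (Real.exp 1 * t)) ^ N * (‖ψ₁‖ ^ 2 + ‖ψ₂‖ ^ 2) := by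
  -- the four polarisation vectors, coefficients and joint spectral measures
  set u : Fin 4 → h.Hilbert := ![ψ₁ + ψ₂, ψ₁ - ψ₂, ψ₁ + Complex.I • ψ₂, ψ₁ - Complex.I • ψ₂] with hu
  set c : Fin 4 → ℂ := ![1 / 4, -(1 / 4), -(Complex.I / 4), Complex.I / 4] with hc
  have hμ : ∀ k, h.IsJointSpectralMeasure (u k) (h.jointSpectralMeasure (u k)) := fun k =>
    h.isJointSpectralMeasure_of_exists OSReconstructionNoE1.exists_isJointSpectralMeasure_holds (u k)
  haveI : ∀ k, IsFiniteMeasure (h.jointSpectralMeasure (u k)) := fun k => (hμ k).isFiniteMeasure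
  -- the Laplace moments and their combination
  set L : Fin 4 → ℕ → ℝ → ℝ := fun k j τ =>
    ∫ p, (-(p 0)) ^ j * Real.exp (-(τ * p 0)) ∂(h.jointSpectralMeasure (u k)) with hL
  set P : ℕ → ℝ → ℂ := fun j τ => ∑ k, c k * (L k j τ : ℂ) with hP
  -- (i) `G 0 = P 0` on `t > 0`
  have hP0 : ∀ τ : ℝ, 0 < τ → G 0 τ = P 0 τ := by
    intro τ hτ
    rw [h0 τ hτ, inner_transfer_polarization, hP]
    simp only [Fin.sum_univ_four, hc, hu, hL, Matrix.cons_val_zero, Matrix.cons_val_one,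
      Matrix.cons_val, ← inner_transfer_eq_laplace h _ hτ.le]
    ring
  -- (ii) `Pⱼ' = Pⱼ₊₁` on `t > 0`
  have hPd : ∀ (j : ℕ) (τ : ℝ), 0 < τ → HasDerivAt (P j) (P (j + 1) τ) τ := by
    intro j τ hτ
    have hk : ∀ k ∈ (Finset.univ : Finset (Fin 4)),
        HasDerivAt (fun σ : ℝ => c k * (L k j σ : ℂ)) (c k * (L k (j + 1) τ : ℂ)) τ := fun k _ =>
      ((hasDerivAt_laplace_moment (hμ k).energy_nonneg j hτ).ofReal_comp).const_mul (c k)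
    have := HasDerivAt.fun_sum hk
    simpa [hP] using this
  -- (iii) identification of the derivatives by induction
  have hGP : ∀ (j : ℕ) (τ : ℝ), 0 < τ → G j τ = P j τ := by
    intro j
    induction j with
    | zero => exact hP0
    | succ j ih =>
      intro τ hτ
      have hev : G j =ᶠ[𝓝 τ] P j := by
        filter_upwards [Ioi_mem_nhds hτ] with σ hσ using ih σ hσ
      exact (hd j τ hτ).unique ((hPd j τ hτ).congr_of_eventuallyEq hev)
  -- (iv) the bound
  rw [hGP N t ht]
  have hLk : ∀ k, ‖(L k N t : ℂ)‖ ≤ (N / (Real.exp 1 * t)) ^ N * ‖u k‖ ^ 2 := by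
    intro k
    rw [Complex.norm_real, ← (hμ k).measureReal_univ h]
    exact norm_laplace_moment_le (hμ k).energy_nonneg N ht
  have hck : ∀ k, ‖c k‖ = 1 / 4 := by
    intro k
    fin_cases k <;> simp [hc]
  calc ‖P N t‖ ≤ ∑ k, ‖c k * (L k N t : ℂ)‖ := norm_sum_le _ _
    _ ≤ ∑ k, 1 / 4 * ((N / (Real.exp 1 * t)) ^ N * ‖u k‖ ^ 2) :=
        Finset.sum_le_sum fun k _ => by
          rw [norm_mul, hck]
          exact mul_le_mul_of_nonneg_left (hLk k) (by norm_num)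
    _ = (N / (Real.exp 1 * t)) ^ N * (1 / 4 * ∑ k, ‖u k‖ ^ 2) := by
        rw [← Finset.mul_sum, ← Finset.mul_sum]; ring
    _ = (N / (Real.exp 1 * t)) ^ N * (‖ψ₁‖ ^ 2 + ‖ψ₂‖ ^ 2) := by
        congr 1
        simp only [Fin.sum_univ_four, hu, Matrix.cons_val_zero, Matrix.cons_val_one, Matrix.cons_val]
        have p1 := parallelogram_law_with_norm ℂ ψ₁ ψ₂
        have p2 := parallelogram_law_with_norm ℂ ψ₁ (Complex.I • ψ₂)
        rw [norm_smul, Complex.norm_I, one_mul] at p2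
        linarith

end Hilbert

/-- **Sub-goal `SemigroupDerivativeBound`** (helper for stub `ChartDerivativeBounds`): the
generator-free Osterwalder–Schrader estimate `|dᴺ/dtᴺ ⟪ψ₁, e^{-tH}ψ₂⟫| ≤ (N/(et))ᴺ (‖ψ₁‖² + ‖ψ₂‖²)`
for any chain `G` of successive derivatives starting at `t ↦ ⟪ψ₁, e^{-tH}ψ₂⟫` (OS 1973 §4.1;
Glimm–Jaffe Thm. 6.1.3). [folklore] -/
theorem SemigroupDerivativeBound : open Literature.MathematicalPhysics.AQFT Literature.MathematicalPhysics.QuantumFieldTheory in ∀ {ι : Type*} {d : ℕ} [NeZero d] {S : LabelledSchwingerFamily ι (EuclideanSpace ℝ (Fin d))} (h : OSReconstructionNoE1 S) (ψ₁ ψ₂ : h.Hilbert) (G : ℕ → ℝ → ℂ), (∀ t : ℝ, 0 < t → G 0 t = inner ℂ ψ₁ (h.transfer t ψ₂)) → (∀ (j : ℕ) (t : ℝ), 0 < t → HasDerivAt (G j) (G (j + 1) t) t) → ∀ (N : ℕ) (t : ℝ), 0 < t → ‖G N t‖ ≤ (N / (Real.exp 1 * t)) ^ N * (‖ψ₁‖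 ^ 2 + ‖ψ₂‖ ^ 2) := by
  intro ι d _ S h ψ₁ ψ₂ G h0 hd N t ht
  exact norm_iterDeriv_inner_transfer_le h ψ₁ ψ₂ G h0 hd N ht

end Summit.QuantumFields.YangMills.Theorems.CurvatureKernel
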